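/-
Origin: expansion seat `planner-pub-hodgecm-toy-0`, handover #2 2026-08-18T04:13:45Z (`HOME/pub-hodgecm-toy/lean/Toy/Isogeny.lean`, md5 40e3bed9, 340 lines);
landed by the gen-5 packager in gate run 21 as `HodgeCM/Model/Toy/Isogeny.lean` (import ^import Toy\.→import HodgeCM.Model.Toy. ×1).
-/
-- HANDOVER (planner-pub-hodgecm-toy-0, unit pub-hodgecm-toy): WIP module `Toy.Isogeny`; intended final module
-- `HodgeCM.Model.Toy.Isogeny` (kind L5, toy model / consistency witness); rename `import Toy.X` ↦ the final prefix.
/-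
Copyright: pub-hodgecm cell (HodgeCMPerL). Consistency-witness layer (part (e), referee A G4).

# CM facts in the toy universe: the conjugate isogeny (M25) and CM domination (M17)

* M25: complex conjugation of `K`, transported to the lattice `Unit → FK K`, is a Hodge isomorphism
  `A_{(K,Φ̄)} → A_{(K,Φ)}` intertwining `ι(a)` with `ι(ā)`.
* M17: given a **Galois CM closure oracle** (for every CM field `K` a Galois CM field `F ⊇ K` of degree
  `≥ 6` — a theorem of algebraic number theory not available in Mathlib, kept as a typed hypothesis),
  `A_{(K,Φ)}` is dominated by `A_{(F,Θ)}` (`Θ` the induced type) with `N = 1`: `s = [F:K]⁻¹·Tr_{F/K}`,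
  `π =` the inclusion, `π ∘ s = id` on `H¹`.
-/
import Mathlib
import Summits.HodgeConjecture.HodgeCM.Model.Toy.CMFacts

namespace HodgeCM.Toy

open Literature.AlgebraicGeometry.Motives
open Literature.AlgebraicGeometry.Motives.HodgeStructure (EndAction conj ofRat)
open Literature.AlgebraicGeometry.ShimuraVarieties (conjRingHomK embedding_conjRingHomK)
open scoped TensorProduct
open exteriorPower CMPresentation

noncomputable section

/-! ### Base change of ring homomorphisms -/

section ringHom

variable {F₁ F₂ : Type} [Field F₁] [Field F₂] [Algebra ℚ F₁] [Algebra ℚ F₂]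

/-- (Ported verbatim from the HodgeCMPerL package; no docstring in the source.) -/
lemma baseChange_algHom_eq (g : F₁ →ₐ[ℚ] F₂) :
    g.toLinearMap.baseChange ℂ = (Algebra.TensorProduct.map (AlgHom.id ℂ ℂ) g).toLinearMap := by
  apply TensorProduct.AlgebraTensorModule.ext
  intro a b
  simp

/-- (Ported verbatim from the HodgeCMPerL package; no docstring in the source.) -/
lemma baseChange_algHom_mul (g : F₁ →ₐ[ℚ] F₂) (x y : ℂ ⊗[ℚ] F₁) :
    g.toLinearMap.baseChange ℂ (x * y) = g.toLinearMap.baseChange ℂ x * g.toLinearMap.baseChange ℂ y := by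
  rw [baseChange_algHom_eq]; exact map_mul (Algebra.TensorProduct.map (AlgHom.id ℂ ℂ) g) x y

/-- `(1 ⊗ g k) · g_ℂ(x) = g_ℂ((1 ⊗ k) · x)` -/
lemma tmul_mul_baseChange_algHom (g : F₁ →ₐ[ℚ] F₂) (k : F₁) (x : ℂ ⊗[ℚ] F₁) :
    (1 ⊗ₜ[ℚ] g k) * g.toLinearMap.baseChange ℂ x = g.toLinearMap.baseChange ℂ ((1 ⊗ₜ[ℚ] k) * x) := by
  rw [baseChange_algHom_mul]
  simp [LinearMap.baseChange_tmul]

end ringHom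

/-! ### Lattice maps of the form `compLeft` on one-atom objects -/

section compLeft

variable {X Y : Obj} (hX : X.s = .unit) 

/-- For one-atom objects with lattices `Unit → F₁`, `Unit → F₂`: `(g.compLeft)_ℂ (eT () τ) = single_ℂ (g_ℂ (eps τ))`. -/
lemma compLeft_comp_single {F₁ F₂ : Type} [AddCommGroup F₁] [AddCommGroup F₂] [Module ℚ F₁] [Module ℚ F₂]
    (g : F₁ →ₗ[ℚ] F₂) :
    g.compLeft Unit ∘ₗ LinearMap.single ℚ (fun _ : Unit => F₁) () = LinearMap.single ℚ (fun _ : Unit => F₂) () ∘ₗ g := by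
  refine LinearMap.ext fun y => funext fun u => ?_
  cases u
  simp

end compLeft

/-! ### M25: the conjugate isogeny -/

section conjIso

variable (K : CMField)

/-- (Ported verbatim from the HodgeCMPerL package; no docstring in the source.) -/
lemma conjRingHomK_apply_apply (x : K) : conjRingHomK K (conjRingHomK K x) = x :=
  NumberField.IsCMField.complexConj_apply_apply (K : Type) x

/-- complex conjugation transported to `FK K` -/
def cF : FK K →+* FK K := ((eK K : K →+* FK K).comp (conjRingHomK K)).comp ((eK K).symm : FK K →+* K)

/-- (Ported verbatim from the HodgeCMPerL package; no docstring in the source.) -/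
@[simp] lemma cF_eK (x : K) : cF K (eK K x) = eK K (conjRingHomK K x) := by simp [cF]

/-- (Ported verbatim from the HodgeCMPerL package; no docstring in the source.) -/
@[simp] lemma cF_cF (y : FK K) : cF K (cF K y) = y := by
  obtain ⟨x, rfl⟩ := (eK K).surjective y
  rw [cF_eK, cF_eK, conjRingHomK_apply_apply]

/-- (Ported verbatim from the HodgeCMPerL package; no docstring in the source.) -/
lemma emb_cF (τ : FK K →+* ℂ) (y : FK K) : τ (cF K y) = starRingEnd ℂ (τ y) := by
  obtain ⟨x, rfl⟩ := (eK K).surjective y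
  rw [cF_eK]
  exact embedding_conjRingHomK K (τ.comp (eK K : K →+* FK K)) x

/-- (Ported verbatim from the HodgeCMPerL package; no docstring in the source.) -/
lemma comp_cF_comp_eK (τ : FK K →+* ℂ) :
    (τ.comp (cF K)).comp (eK K : K →+* FK K) = NumberField.ComplexEmbedding.conjugate (τ.comp (eK K : K →+* FK K)) := by
  ext x
  simp only [RingHom.comp_apply, emb_cF]
  rfl

/-- as a `ℚ`-algebra map and a `ℚ`-linear equivalence -/
def cFa : FK K →ₐ[ℚ] FK K := (cF K).toRatAlgHom

/-- (Ported verbatim from the HodgeCMPerL package; no docstring in the source.) -/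
def cFl : FK K ≃ₗ[ℚ] FK K :=
  { (cFa K).toLinearMap with
    invFun := cF K
    left_inv := cF_cF K
    right_inv := cF_cF K }

/-- (Ported verbatim from the HodgeCMPerL package; no docstring in the source.) -/
@[simp] lemma cFl_apply (y : FK K) : cFl K y = cF K y := rfl

/-- (Ported verbatim from the HodgeCMPerL package; no docstring in the source.) -/
lemma cFl_toLinearMap : (cFl K).toLinearMap = (cFa K).toLinearMap := rfl

/-- `cF_ℂ (eps τ)` is a joint eigenvector of character `τ ∘ cF`. -/
lemma cF_baseChange_eps_mem (τ : FK K →+* ℂ) :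
    (cFa K).toLinearMap.baseChange ℂ (eps (FK K) τ) ∈ Submodule.span ℂ {eps (FK K) (τ.comp (cF K))} := by
  apply mem_span_eps_of_eigen
  intro k
  have := tmul_mul_baseChange_algHom (cFa K) (cF K k) (eps (FK K) τ)
  rw [show (cFa K) (cF K k) = k from cF_cF K k, tmul_mul_eps, map_smul] at this
  rw [this]
  rfl

variable (Φ Φ' : CMType K)

/-- the lattice map of the conjugate isogeny -/
def uEquiv : (cmObj K Φ').L ≃ₗ[ℚ] (cmObj K Φ).L := LinearEquiv.piCongrRight fun _ : Unit => cFl K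

/-- (Ported verbatim from the HodgeCMPerL package; no docstring in the source.) -/
lemma uEquiv_toLinearMap : (uEquiv K Φ Φ').toLinearMap = (cFa K).toLinearMap.compLeft Unit := by
  refine LinearMap.ext fun v => funext fun u => ?_
  rfl

/-- (Ported verbatim from the HodgeCMPerL package; no docstring in the source.) -/
lemma isHodge_uEquiv (h : ∀ φ : K →+* ℂ, φ ∈ Φ'.1 ↔ NumberField.ComplexEmbedding.conjugate φ ∈ Φ.1) :
    Obj.IsHodge (X := cmObj K Φ) (Y := cmObj K Φ') (uEquiv K Φ Φ').toLinearMap := by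
  rw [Obj.isHodge_iff]
  rintro ⟨⟩ τ hτ
  rw [uEquiv_toLinearMap]
  change ((cFa K).toLinearMap.compLeft Unit).baseChange ℂ
      ((LinearMap.single ℚ (fun _ : Unit => (FK K : Type)) ()).baseChange ℂ (eps (FK K) τ)) ∈ _
  rw [← LinearMap.comp_apply, ← LinearMap.baseChange_comp, compLeft_comp_single, LinearMap.baseChange_comp,
    LinearMap.comp_apply]
  have hmem := cF_baseChange_eps_mem K τ
  obtain ⟨c, hc⟩ := Submodule.mem_span_singleton.mp hmem
  rw [← hc, map_smul]
  refine Submodule.smul_mem _ _ (Submodule.subset_span ⟨(), τ.comp (cF K), ?_, rfl⟩)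
  change (τ.comp (cF K)).comp (eK K : K →+* FK K) ∈ Φ.1
  rw [comp_cF_comp_eK]
  exact (h _).mp hτ

/-- the conjugate isogeny `u : A_{(K,Φ)} → A_{(K,Φ')}` (pull-back = `uEquiv`) -/
def uHom (h : ∀ φ : K →+* ℂ, φ ∈ Φ'.1 ↔ NumberField.ComplexEmbedding.conjugate φ ∈ Φ.1) :
    Obj.Hom (cmObj K Φ) (cmObj K Φ') := ⟨(uEquiv K Φ Φ').toLinearMap, isHodge_uEquiv K Φ Φ' h⟩

/-- (Ported verbatim from the HodgeCMPerL package; no docstring in the source.) -/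
lemma uEquiv_comp_mulK (a : K) :
    (uEquiv K Φ Φ').toLinearMap ∘ₗ mulK K Φ' a = mulK K Φ (conjRingHomK K a) ∘ₗ (uEquiv K Φ Φ').toLinearMap := by
  refine LinearMap.ext fun v => funext fun u => ?_
  simp [uEquiv, mulK, LinearMap.mulLeft_apply, Pi.mul_apply, map_mul]

variable (D : HodgeData)

/-- (Ported verbatim from the HodgeCMPerL package; no docstring in the source.) -/
theorem fact_conjIsogeny : (toyModelWith D).Fact_conjIsogeny := by
  intro K Φ Φ' h
  refine ⟨uHom K Φ Φ' h, ?_, fun a => ?_⟩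
  · change Function.Bijective (map 1 (uEquiv K Φ Φ').toLinearMap)
    rw [map_one_eq]
    exact ((oneEquiv ℚ _).trans ((uEquiv K Φ Φ').trans (oneEquiv ℚ _).symm)).bijective
  · simp only [cmAction_ι]
    change map 1 (uEquiv K Φ Φ').toLinearMap ∘ₗ map 1 (mulK K Φ' a)
      = map 1 (mulK K Φ (conjRingHomK K a)) ∘ₗ map 1 (uEquiv K Φ Φ').toLinearMap
    rw [← map_comp, ← map_comp, uEquiv_comp_mulK]

end conjIso

/-! ### M17: CM domination, from a Galois CM closure oracle -/

/-- **Galois CM closure oracle**: every CM field embeds in a Galois CM field of degree `≥ 6`.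
(True: the Galois closure of a CM field is CM, and its compositum with a cyclic cubic real field is CM
and Galois — Shimura, *Abelian varieties with CM* (1998) §18.2; Milne, *Complex Multiplication* §1.
Not in Mathlib; kept as an explicit typed hypothesis of the consistency witness.) -/
structure GaloisCMOracle : Type 1 where
  /-- the Galois CM field over `K` -/
  F : CMField → CMField
  gal : ∀ K, IsGalois ℚ (F K)
  six : ∀ K, 6 ≤ Module.finrank ℚ (F K)
  /-- the embedding `K ↪ F K` -/
  emb : ∀ K : CMField, (K : Type) →+* (F K : Type)

section domination

variable (K F : CMField) (j : (K : Type) →+* (F : Type)) (Φ : CMType K)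

/-- the CM type of `F` induced from `Φ` along `j` -/
def inducedType : CMType F :=
  ⟨{τ | τ.comp j ∈ Φ.1}, fun φ => by
    change φ.comp j ∈ Φ.1 ↔ ¬ (NumberField.ComplexEmbedding.conjugate φ).comp j ∈ Φ.1
    have : (NumberField.ComplexEmbedding.conjugate φ).comp j = NumberField.ComplexEmbedding.conjugate (φ.comp j) :=
      RingHom.ext fun _ => rfl
    rw [this]
    exact Φ.2 _⟩

/-- `FK K → FK F` transported from `j` -/
def jj : FK K →ₐ[ℚ] FK F := (((eK F : F →+* FK F).comp j).comp ((eK K).symm : FK K →+* K)).toRatAlgHom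

/-- (Ported verbatim from the HodgeCMPerL package; no docstring in the source.) -/
@[simp] lemma jj_eK (x : K) : jj K F j (eK K x) = eK F (j x) := by simp [jj]

/-- the averaged trace `[F:K]⁻¹ · Tr_{F/K}`, transported -/
def tt : FK F →ₗ[ℚ] FK K :=
  letI : Algebra K F := j.toAlgebra
  ((Module.finrank K F : ℚ)⁻¹) •
    ((eK K).toLinearMap ∘ₗ (Algebra.trace K F).restrictScalars ℚ ∘ₗ (eK F).symm.toLinearMap)

/-- (Ported verbatim from the HodgeCMPerL package; no docstring in the source.) -/
lemma finrank_KF_ne_zero : letI : Algebra K F := j.toAlgebra; (Module.finrank K F : ℚ) ≠ 0 := by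
  letI : Algebra K F := j.toAlgebra
  haveI : Module.Finite K F := Module.Finite.of_restrictScalars_finite ℚ K F
  exact_mod_cast (Module.finrank_pos (R := K) (M := F)).ne'

/-- (Ported verbatim from the HodgeCMPerL package; no docstring in the source.) -/
lemma tt_jj (y : FK K) : tt K F j (jj K F j y) = y := by
  obtain ⟨x, rfl⟩ := (eK K).surjective y
  letI : Algebra K F := j.toAlgebra
  haveI : Module.Finite K F := Module.Finite.of_restrictScalars_finite ℚ K F
  rw [jj_eK]
  simp only [tt, LinearMap.smul_apply, LinearMap.coe_comp, Function.comp_apply, AlgEquiv.toLinearMap_apply,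
    LinearMap.coe_restrictScalars, AlgEquiv.symm_apply_apply]
  rw [show j x = algebraMap K F x from rfl, Algebra.trace_algebraMap, map_nsmul, ← Nat.cast_smul_eq_nsmul ℚ,
    smul_smul, inv_mul_cancel₀ (finrank_KF_ne_zero K F j), one_smul]

/-- `K`-linearity of the averaged trace: `tt (jj k · y) = k · tt y` -/
lemma tt_mul (k : FK K) (y : FK F) : tt K F j (jj K F j k * y) = k * tt K F j y := by
  obtain ⟨x, rfl⟩ := (eK K).surjective k
  obtain ⟨z, rfl⟩ := (eK F).surjective y
  letI : Algebra K F := j.toAlgebra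
  rw [jj_eK, ← map_mul]
  simp only [tt, LinearMap.smul_apply, LinearMap.coe_comp, Function.comp_apply, AlgEquiv.toLinearMap_apply,
    LinearMap.coe_restrictScalars, AlgEquiv.symm_apply_apply]
  rw [show j x * z = x • z from rfl, LinearMap.map_smul, smul_eq_mul, map_mul, mul_smul_comm]

variable (Θ : CMType F)

/-- `π : A_{(F,Θ)} → A_{(K,Φ)}` — pull-back `= jj` on lattices -/
def piLin : (cmObj K Φ).L →ₗ[ℚ] (cmObj F Θ).L := (jj K F j).toLinearMap.compLeft Unit

/-- `s : A_{(K,Φ)} → A_{(F,Θ)}` — pull-back `= tt` on lattices -/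
def sLin : (cmObj F Θ).L →ₗ[ℚ] (cmObj K Φ).L := (tt K F j).compLeft Unit

/-- (Ported verbatim from the HodgeCMPerL package; no docstring in the source.) -/
lemma sLin_comp_piLin : sLin K F j Φ Θ ∘ₗ piLin K F j Φ Θ = LinearMap.id := by
  refine LinearMap.ext fun v => funext fun u => ?_
  simp [sLin, piLin, tt_jj]

/-- (Ported verbatim from the HodgeCMPerL package; no docstring in the source.) -/
lemma mem_inducedAtom_iff (τ' : FK F →+* ℂ) :
    τ' ∈ (atomOf F (inducedType K F j Φ)).Φ ↔ (τ'.comp (eK F : F →+* FK F)).comp j ∈ Φ.1 := Iff.rfl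

/-- (Ported verbatim from the HodgeCMPerL package; no docstring in the source.) -/
lemma comp_jj_comp_eK (τ' : FK F →+* ℂ) :
    (τ'.comp (jj K F j : FK K →+* FK F)).comp (eK K : K →+* FK K) = (τ'.comp (eK F : F →+* FK F)).comp j := by
  ext x; simp

/-- `jj_ℂ (eps τ)` lies in the span of the `eps τ'` with `τ' ∘ jj = τ`. -/
lemma jj_baseChange_eps_mem (τ : FK K →+* ℂ) :
    (jj K F j).toLinearMap.baseChange ℂ (eps (FK K) τ) ∈
      Submodule.span ℂ (eps (FK F) '' {τ' | τ'.comp (jj K F j : FK K →+* FK F) = τ}) := by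
  classical
  set y := (jj K F j).toLinearMap.baseChange ℂ (eps (FK K) τ) with hy
  have hsum : y = ∑ τ' : FK F →+* ℂ, y * eps (FK F) τ' := by rw [← Finset.mul_sum, sum_eps, mul_one]
  rw [hsum]
  refine Submodule.sum_mem _ fun τ' _ => ?_
  by_cases hτ' : τ'.comp (jj K F j : FK K →+* FK F) = τ
  · have h1 : Submodule.span ℂ {eps (FK F) τ'}
        ≤ Submodule.span ℂ (eps (FK F) '' {τ' | τ'.comp (jj K F j : FK K →+* FK F) = τ}) :=
      Submodule.span_mono (Set.singleton_subset_iff.mpr ⟨τ', hτ', rfl⟩)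
    exact h1 (mul_eps_mem_span τ' y)
  · obtain ⟨k, hk⟩ := exists_apply_ne_of_ne hτ'
    have heig : (1 ⊗ₜ[ℚ] (jj K F j k)) * y = τ k • y := by
      rw [hy, tmul_mul_baseChange_algHom, tmul_mul_eps, map_smul]
    rw [mul_eps_eq_zero_of_eigen heig (Ne.symm hk)]
    exact Submodule.zero_mem _

/-- (Ported verbatim from the HodgeCMPerL package; no docstring in the source.) -/
lemma isHodge_piLin : Obj.IsHodge (X := cmObj F (inducedType K F j Φ)) (Y := cmObj K Φ)
    (piLin K F j Φ (inducedType K F j Φ)) := by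
  rw [Obj.isHodge_iff]
  rintro ⟨⟩ τ hτ
  change ((jj K F j).toLinearMap.compLeft Unit).baseChange ℂ
      ((LinearMap.single ℚ (fun _ : Unit => (FK K : Type)) ()).baseChange ℂ (eps (FK K) τ)) ∈ _
  rw [← LinearMap.comp_apply, ← LinearMap.baseChange_comp, compLeft_comp_single, LinearMap.baseChange_comp,
    LinearMap.comp_apply]
  have hmem := jj_baseChange_eps_mem K F j τ
  have hle : Submodule.span ℂ (eps (FK F) '' {τ' | τ'.comp (jj K F j : FK K →+* FK F) = τ})
      ≤ (cmObj F (inducedType K F j Φ)).F1.comap ((LinearMap.single ℚ (fun _ : Unit => (FK F : Type)) ()).baseChange ℂ) := by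
    rw [Submodule.span_le]
    rintro _ ⟨τ', hτ', rfl⟩
    refine Submodule.subset_span ⟨(), τ', ?_, rfl⟩
    rw [mem_inducedAtom_iff, ← comp_jj_comp_eK, hτ']
    exact hτ
  exact hle hmem

/-- `tt_ℂ (eps τ')` is a joint eigenvector of character `τ' ∘ jj`. -/
lemma tt_baseChange_eps_mem (τ' : FK F →+* ℂ) :
    (tt K F j).baseChange ℂ (eps (FK F) τ') ∈ Submodule.span ℂ {eps (FK K) (τ'.comp (jj K F j : FK K →+* FK F))} := by
  apply mem_span_eps_of_eigen
  intro k
  have h1 : LinearMap.mulLeft ℚ k ∘ₗ tt K F j = tt K F j ∘ₗ LinearMap.mulLeft ℚ (jj K F j k) := by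
    refine LinearMap.ext fun y => ?_
    simp [LinearMap.mulLeft_apply, tt_mul]
  have h2 := congrArg (fun g => LinearMap.baseChange ℂ g (eps (FK F) τ')) h1
  simp only [LinearMap.baseChange_comp, LinearMap.comp_apply, baseChange_mulLeft, tmul_mul_eps, map_smul] at h2
  rw [h2]
  rfl

/-- (Ported verbatim from the HodgeCMPerL package; no docstring in the source.) -/
lemma isHodge_sLin : Obj.IsHodge (X := cmObj K Φ) (Y := cmObj F (inducedType K F j Φ))
    (sLin K F j Φ (inducedType K F j Φ)) := by
  rw [Obj.isHodge_iff]
  rintro ⟨⟩ τ' hτ'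
  change ((tt K F j).compLeft Unit).baseChange ℂ
      ((LinearMap.single ℚ (fun _ : Unit => (FK F : Type)) ()).baseChange ℂ (eps (FK F) τ')) ∈ _
  rw [← LinearMap.comp_apply, ← LinearMap.baseChange_comp, compLeft_comp_single, LinearMap.baseChange_comp,
    LinearMap.comp_apply]
  obtain ⟨c, hc⟩ := Submodule.mem_span_singleton.mp (tt_baseChange_eps_mem K F j τ')
  rw [← hc, map_smul]
  refine Submodule.smul_mem _ _ (Submodule.subset_span ⟨(), τ'.comp (jj K F j : FK K →+* FK F), ?_, rfl⟩)
  change (τ'.comp (jj K F j : FK K →+* FK F)).comp (eK K : K →+* FK K) ∈ Φ.1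
  rw [comp_jj_comp_eK]
  exact hτ'

/-- `π` and `s` as morphisms -/
def piHom : Obj.Hom (cmObj F (inducedType K F j Φ)) (cmObj K Φ) := ⟨_, isHodge_piLin K F j Φ⟩
/-- (Ported verbatim from the HodgeCMPerL package; no docstring in the source.) -/
def sHom : Obj.Hom (cmObj K Φ) (cmObj F (inducedType K F j Φ)) := ⟨_, isHodge_sLin K F j Φ⟩

/-- (Ported verbatim from the HodgeCMPerL package; no docstring in the source.) -/
lemma sHom_comp_piHom : (sHom K F j Φ).comp (piHom K F j Φ) = Obj.Hom.id _ :=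
  Obj.Hom.ext (sLin_comp_piLin K F j Φ _)

end domination

variable (D : HodgeData)

/-- **M17 from the oracle.** -/
theorem fact_cmDominated (O : GaloisCMOracle) : (toyModelWith D).Fact_cmDominated := by
  rintro X ⟨K, Φ, rfl⟩
  refine ⟨O.F K, O.gal K, O.six K, 0, fun _ => inducedType K (O.F K) (O.emb K) Φ,
    sHom K (O.F K) (O.emb K) Φ, piHom K (O.F K) (O.emb K) Φ, 1, one_ne_zero, fun k => ?_⟩
  change map k ((sHom K (O.F K) (O.emb K) Φ).comp (piHom K (O.F K) (O.emb K) Φ)).lin = _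
  rw [sHom_comp_piHom, Nat.cast_one, one_pow, one_smul]
  exact map_id

end

end HodgeCM.Toy
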